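/-
Copyright (c) 2026 the pub-hodgecm-mathlib formalisation cell (harness21).  Prover seat hodgecm-mathlib-LH10-p01 (g12): road M6 → F5 → dyadic chain of `stub_DyUnramCore` (D-UNR),
brick (L2-1)-dy «BOUNDARY VALUES, 2-FREE» part 4∕4 — ORGAN V (BD-half) `exists_boundaryValues_of_levelTwo` with `h2` DELETED; 2026-09-03.
-/
import Literature.NumberTheory.Rogawski1990.LevelTwoPieceBoundaryValues                      -- ★ (F0P3a-p06) the `v ∤ 2` originals and their 2-free helpers (`exists_v_mul_map_sub_lt_one_of_inert`, `apply_eq_of_conj_eq_levelTwo_mul`, the frame kit)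
import Literature.NumberTheory.Automorphic.UnitaryThreeBoundaryRigidityLevelTwoUnitFactorOfTrace  -- ★-to-be (this seat, part 3∕4): RIGID-2 unit-factor form with `h2` deleted
import HarnessLib

/-!
# Level-2 `K`-class pieces: the two BOUNDARY VALUES in EVERY residue characteristic (organ V, BD-half, with `h2` DELETED — dyadic `v ∣ 2` included)

Topic `NumberTheory/Rogawski1990`; namespace `Literature.NumberTheory.Rogawski1990`.  THEOREMS ONLY (no definition, no instance, no notation, no named fact, no `sorry`);
kernel lane `--supports stmt-HodgeConjecture-24833`.  Cell `pub/hodgecm-mathlib` (D-0151), crux H413 = `stmt-HodgeConjecture-24833`; road M6 → F5 → the DYADIC CHAIN of organ (D-UNR)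
`stub_DyUnramCore` (`Cruxes/H413/Lines/F0_P3c_DyadicPaydown.lean` :103), LEVEL TWO, site (L2-1) of the h2-map (CENSUS-LEVEL2-h2 v1): ★ `exists_boundaryValues_of_levelTwo`
(`LevelTwoPieceBoundaryValues` :335) and its heart `apply_eq_of_two_deep_of_rank_redMat_sub_one` (:187) carry `h2 : IsUnit (2 : 𝒪_w)` ONLY as `v 2 = 1` for the two RIGID-2
unit-factor calls (:315, :323).  Parts 1–3 (`UnitaryThreeLevelTwoHeisenbergClassesOfTrace` → `…BoundaryRigidityLevelTwoOfTrace` → `…UnitFactorOfTrace`) prove RIGID-2 with `h2`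
deleted (the θ-device on ★ `UnramifiedLocalConjDatum.trace`), so this file is ★ VERBATIM for those two declarations with the binder `h2` (×2) and the line `h2v` removed and the
two calls re-sourced; ★'s 2-free helpers are imported, not re-declared.  A dyadic twin of ★ `liftOneTwo` calls `exists_boundaryValues_of_levelTwo_anyChar` with ★'s argument list
minus `h2`.  HONEST LABEL: HC_CM is proved only modulo the 7 printed citations (2 remaining named inputs: hLiu418 = stmt-HodgeConjecture-24832, h413 = stmt-HodgeConjecture-24833) until
rung 0 closes; unconditional local algebra, count-neutral (zero label movement until the desk prices the `stub_N6nsDyadic` rider); asserts nothing printed about the transfer.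

* `apply_eq_of_two_deep_of_rank_redMat_sub_one_anyChar` (THE HEART, no `h2`), **`exists_boundaryValues_of_levelTwo_anyChar`** (ORGAN V BD-half, no `h2`).

## References
* [Rogawski1990] J. Rogawski, *Automorphic Representations of Unitary Groups in Three Variables*, Ann. of Math. Stud. 123 (1990), §3.9 p. 32, Prop. 3.9.1; §4.9 p. 54.
* [Tits1979] J. Tits, *Reductive groups over local fields*, PSPM 33.1 (1979), §3.5.
* [Kottwitz1986BaseChangeUnits] R. Kottwitz, *Base change for unit elements of Hecke algebras*, Compositio Math. 60 (1986), §1 pp. 240–241.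
-/

set_option autoImplicit false

noncomputable section

open NumberField IsDedekindDomain Matrix ValuativeRel
open Literature.NumberTheory.Automorphic Literature.NumberTheory.GaloisRepresentations Literature.NumberTheory.Automorphic.UnitaryGroup
open Literature.NumberTheory.Automorphic.IntegralReduction Literature.GroupTheory.SpecificGroups
open Literature.NumberTheory.Automorphic.HermitianLattice Literature.NumberTheory.Automorphic.UnitaryLatticeTree
open scoped Matrix MatrixGroups ValuativeRel

namespace Literature.NumberTheory.Rogawski1990

section OrganVBoundary

set_option maxHeartbeats 400000 in
-- budget only: residue-field bookkeeping at the CM place.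
set_option maxHeartbeats 800000 in
-- budget only: one statement-heavy declaration (the CM-place tokens); no search tactic runs long here.
/-- **THE HEART — the value of a level-2 `K`-class piece at a residually unipotent `x ∈ K` of Jordan rank `1` (resp. `2`) that is
`G′_v`-conjugate into `K(2)` is `g (e⁻¹ n(t₀))` (resp. `g (e⁻¹ u(1,b₀))`).**  In a good-reduction frame `e` (`(e z) = T z_w T⁻¹`,
`T ∈ GL₃(𝒪_w)`, `K ↔ GL₃(𝒪_w)`): the 2-deep conjugate `γ = y x y⁻¹` makes RIGID-2 applicable to `e x = (e y)⁻¹ (e γ) (e y)`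
(★ `exists_conj_eq_levelTwo_mul_cornerUnipotent_of_two_deep` ∕ `…upperUnipotent_one…`: `k (e x) k⁻¹ = u · n` with `k ∈ U(𝒪_w)`,
`u ≡ 1 (ϖ²)`); pulled back along `e`, `k′ x k′⁻¹ = u′ · n_T` with `k′ ∈ K`, `u′ ∈ K(2)`, so `g x = g(k′xk′⁻¹) = g(u′ n_T) = g n_T`.
The Jordan rank of `red(x_w) − 1` is read as RIGID-2's congruences by ★ `rank_redMat_sub_one_eq_zero_iff_forall_valuation_le`
and ★ `redMat_eq_zero_iff_forall_valuation_lt_one`. [cite: Rogawski1990, §3.9 p. 32, Prop. 3.9.1; §4.9 p. 54] [cite: Tits1979, §3.5] [cite: Kottwitz1986BaseChangeUnits, §1 pp. 240–241] -/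
theorem apply_eq_of_two_deep_of_rank_redMat_sub_one_anyChar
    (L : Type) [Field L] [NumberField L] [IsCMField L] (H' : Matrix (Fin 3) (Fin 3) L)
    {v : HeightOneSpectrum (𝓞 ↥(maximalRealSubfield L))}
    (w : PlacesOver L v) (hw : IsCMField.complexConj L • w.1 = w.1) (hv : Algebra.IsUnramifiedIn (𝓞 L) v.asIdeal)
    (g : ((cmDatum L 3 H').Local v) → ℂ)
    (hginv : ∀ u ∈ (cmLocalIntegralLevel L 3 H' v), ∀ x, g (u * x * u⁻¹) = g x)
    (hg2 : ∀ u : ((cmDatum L 3 H').Local v),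
      (∀ a b, Valued.v (((toPlace v w (HeckeCharacter.uniformizer ↥(maximalRealSubfield L) v : v.adicCompletion ↥(maximalRealSubfield L))) ^ 2)⁻¹ * (((((localNonsplitEquiv (IsCMField.complexConj L) H' (IsCMField.complexConj_ne_one L) w hw u) : ↥(unitaryGroupOfForm (galAdicCompletionMap (L := L) (IsCMField.complexConj L) hw) (placeForm H' w.1))) : GL (Fin 3) (w.1.adicCompletion L)) : Matrix (Fin 3) (Fin 3) (w.1.adicCompletion L)) a b - (1 : Matrix (Fin 3) (Fin 3) (w.1.adicCompletion L)) a b)) ≤ 1) →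
      ∀ x, g (u * x) = g x)
    (T : GL (Fin 3) (w.1.adicCompletion L)) (hT : T ∈ glInt 3 (w.1.adicCompletion L))
    (e : ↥(UnitaryGroup.«local» L (IsCMField.complexConj L) 3 H' v) ≃ₜ* ↥(unitaryGroupOfForm (galAdicCompletionMap (L := L) (IsCMField.complexConj L) hw) (placeForm (Matrix.of fun i j : Fin 3 => if i.val + j.val + 1 = 3 then (1 : L) else 0) w.1)))
    (he : ∀ z, ((e z).val : GL (Fin 3) (w.1.adicCompletion L)) = T * (((localNonsplitEquiv (IsCMField.complexConj L) H' (IsCMField.complexConj_ne_one L) w hw z)).val : GL (Fin 3) (w.1.adicCompletion L)) * T⁻¹)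
    (hKe : ∀ z, z ∈ cmLocalIntegralLevel L 3 H' v ↔ ((e z).val : GL (Fin 3) (w.1.adicCompletion L)) ∈ glInt 3 (w.1.adicCompletion L))
    {t₀ b₀ : (w.1.adicCompletion L)} (ht₀ : (galAdicCompletionMap (L := L) (IsCMField.complexConj L) hw) t₀ + t₀ = 0) (ht₀v : Valued.v t₀ = 1)
    (hb₀ : b₀ + (galAdicCompletionMap (L := L) (IsCMField.complexConj L) hw) b₀ + 1 = 0) (hb₀v : Valued.v b₀ ≤ 1)
    (nT uT : ((cmDatum L 3 H').Local v)) (hnT : (((e nT).val : GL (Fin 3) (w.1.adicCompletion L)) : Matrix (Fin 3) (Fin 3) (w.1.adicCompletion L)) = !![1, 0, t₀; 0, 1, 0; 0, 0, 1])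
    (huT : (((e uT).val : GL (Fin 3) (w.1.adicCompletion L)) : Matrix (Fin 3) (Fin 3) (w.1.adicCompletion L)) = !![1, 1, b₀; 0, 1, -1; 0, 0, 1])
    {x : ((cmDatum L 3 H').Local v)} (hxK : x ∈ (cmLocalIntegralLevel L 3 H' v)) (hnil : (redMat (((x).val : GL (Fin 3) (UnitaryGroup.LocalRing L v)).val.map (Pi.evalRingHom (fun w' : PlacesOver L v => w'.1.adicCompletion L) w)) - 1) ^ 3 = 0)
    {y : ((cmDatum L 3 H').Local v)} (hy : (∀ a b, Valued.v (((toPlace v w (HeckeCharacter.uniformizer ↥(maximalRealSubfield L) v : v.adicCompletion ↥(maximalRealSubfield L))) ^ 2)⁻¹ * (((((localNonsplitEquiv (IsCMField.complexConj L) H' (IsCMField.complexConj_ne_one L) w hw (y * x * y⁻¹)) : ↥(unitaryGroupOfForm (galAdicCompletionMap (L := L) (IsCMField.complexConj L) hw) (placeForm H' w.1))) : GL (Fin 3) (w.1.adicCompletion L)) : Matrix (Fin 3) (Fin 3) (w.1.adicCompletion L)) a b - (1 : Matrix (Fin 3) (Fin 3) (w.1.adicCompletion L)) a b)) ≤ 1))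 :
    ((redMat (((x).val : GL (Fin 3) (UnitaryGroup.LocalRing L v)).val.map (Pi.evalRingHom (fun w' : PlacesOver L v => w'.1.adicCompletion L) w)) - 1).rank = 1 → g x = g nT) ∧ ((redMat (((x).val : GL (Fin 3) (UnitaryGroup.LocalRing L v)).val.map (Pi.evalRingHom (fun w' : PlacesOver L v => w'.1.adicCompletion L) w)) - 1).rank = 2 → g x = g uT) := by
  classical
  have hc1 : IsCMField.complexConj L ≠ 1 := IsCMField.complexConj_ne_one L
  -- §0 the place `w`: the `σ`-fixed uniformizer `ϖ_v`, the unramified datum at `ϖ_v`, `|2| = 1`, residual norms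
  have hϖv := Liu2021.LemD1IndexedNonVacuityInertCofinite.valued_toPlace_uniformizer_of_isUnramifiedIn L v hv w
  have hϖ : IsUniformizingElement (toPlace v w (HeckeCharacter.uniformizer ↥(maximalRealSubfield L) v : v.adicCompletion ↥(maximalRealSubfield L))) := isUniformizingElement_of_v_eq hϖv
  have hσϖ : (galAdicCompletionMap (L := L) (IsCMField.complexConj L) hw) (toPlace v w (HeckeCharacter.uniformizer ↥(maximalRealSubfield L) v : v.adicCompletion ↥(maximalRealSubfield L))) = (toPlace v w (HeckeCharacter.uniformizer ↥(maximalRealSubfield L) v : v.adicCompletion ↥(maximalRealSubfield L))) := galAdicCompletionMap_toPlace (IsCMField.complexConj L) w w hw _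
  have hϖ0 : (toPlace v w (HeckeCharacter.uniformizer ↥(maximalRealSubfield L) v : v.adicCompletion ↥(maximalRealSubfield L))) ≠ 0 := by
    intro h; rw [h, map_zero] at hϖv; exact WithZero.coe_ne_zero hϖv.symm
  have hϖ1 : Valued.v (toPlace v w (HeckeCharacter.uniformizer ↥(maximalRealSubfield L) v : v.adicCompletion ↥(maximalRealSubfield L))) < 1 := by
    rw [hϖv, ← WithZero.exp_zero]; exact WithZero.exp_lt_exp.2 (by norm_num)
  obtain ⟨ϖ₀, hd₀⟩ := unramifiedLocalConjDatum_adicCompletion (IsCMField.complexConj L) hc1 v w hw hv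
  have hd : UnramifiedLocalConjDatum (galAdicCompletionMap (L := L) (IsCMField.complexConj L) hw) (toPlace v w (HeckeCharacter.uniformizer ↥(maximalRealSubfield L) v : v.adicCompletion ↥(maximalRealSubfield L))) := ⟨hd₀.σσ, hd₀.vσ, hσϖ, hϖv, hd₀.trace, hd₀.norm⟩
  have hN : ∀ u : (w.1.adicCompletion L), (galAdicCompletionMap (L := L) (IsCMField.complexConj L) hw) u = u → Valued.v u = 1 → ∃ z : (w.1.adicCompletion L), Valued.v (z * (galAdicCompletionMap (L := L) (IsCMField.complexConj L) hw) z - u) < 1 :=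
    fun u hσu hu => exists_v_mul_map_sub_lt_one_of_inert L w hw hv u hσu hu
  -- §1 the frame: `placeForm Φ₃ w = J₀`, memberships, integrality of `T`
  have hJw : placeForm (Matrix.of fun i j : Fin 3 => if i.val + j.val + 1 = 3 then (1 : L) else 0) w.1 = ((StdForm.antidiagonal 3).over (w.1.adicCompletion L)) := by
    rw [placeForm, antidiagOne_eq_over, StdForm.over_map]
  have hU : ∀ z, ((e z).val : GL (Fin 3) (w.1.adicCompletion L)) ∈ (unitaryGroupOfForm (galAdicCompletionMap (L := L) (IsCMField.complexConj L) hw) ((StdForm.antidiagonal 3).over (w.1.adicCompletion L))) := fun z => by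
    rw [← hJw]; exact (e z).2
  have hTi : IsIntMatrix (T : Matrix (Fin 3) (Fin 3) (w.1.adicCompletion L)) := ((mem_glInt_iff_isIntMatrix L 3 w T).1 hT).1
  have hTi' : IsIntMatrix ((T⁻¹ : GL (Fin 3) (w.1.adicCompletion L)) : Matrix (Fin 3) (Fin 3) (w.1.adicCompletion L)) := ((mem_glInt_iff_isIntMatrix L 3 w T).1 hT).2
  have hTT' : (T : Matrix (Fin 3) (Fin 3) (w.1.adicCompletion L)) * ((T⁻¹ : GL (Fin 3) (w.1.adicCompletion L)) : Matrix (Fin 3) (Fin 3) (w.1.adicCompletion L)) = 1 := by rw [← Units.val_mul, mul_inv_cancel, Units.val_one]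
  have hT'T : ((T⁻¹ : GL (Fin 3) (w.1.adicCompletion L)) : Matrix (Fin 3) (Fin 3) (w.1.adicCompletion L)) * (T : Matrix (Fin 3) (Fin 3) (w.1.adicCompletion L)) = 1 := by rw [← Units.val_mul, inv_mul_cancel, Units.val_one]
  -- §2 opaque names for the images of `x`, `y`, `γ = y x y⁻¹` in the two models
  obtain ⟨X₀, hX₀⟩ : ∃ X : GL (Fin 3) (w.1.adicCompletion L), X = (((localNonsplitEquiv (IsCMField.complexConj L) H' (IsCMField.complexConj_ne_one L) w hw x)).val : GL (Fin 3) (w.1.adicCompletion L)) := ⟨_, rfl⟩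
  obtain ⟨Γ₀, hΓ₀⟩ : ∃ X : GL (Fin 3) (w.1.adicCompletion L), X = (((localNonsplitEquiv (IsCMField.complexConj L) H' (IsCMField.complexConj_ne_one L) w hw (y * x * y⁻¹))).val : GL (Fin 3) (w.1.adicCompletion L)) := ⟨_, rfl⟩
  obtain ⟨XR, hXR⟩ : ∃ X : GL (Fin 3) (w.1.adicCompletion L), X = ((e x).val : GL (Fin 3) (w.1.adicCompletion L)) := ⟨_, rfl⟩
  obtain ⟨GR, hGR⟩ : ∃ X : GL (Fin 3) (w.1.adicCompletion L), X = ((e y).val : GL (Fin 3) (w.1.adicCompletion L)) := ⟨_, rfl⟩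
  obtain ⟨ΓR, hΓR⟩ : ∃ X : GL (Fin 3) (w.1.adicCompletion L), X = ((e (y * x * y⁻¹)).val : GL (Fin 3) (w.1.adicCompletion L)) := ⟨_, rfl⟩
  have hXRT : XR = T * X₀ * T⁻¹ := by rw [hXR, hX₀]; exact he x
  have hΓRT : ΓR = T * Γ₀ * T⁻¹ := by rw [hΓR, hΓ₀]; exact he _
  have he1 : e (y * x * y⁻¹) = e (y * x) * e y⁻¹ := map_mul e _ _
  have he2 : e (y * x) = e y * e x := map_mul e _ _
  have he3 : e y⁻¹ = (e y)⁻¹ := map_inv e _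
  have hΓprod : ΓR = GR * XR * GR⁻¹ := by
    rw [hΓR, hGR, hXR, he1, he2, he3]; rfl
  have hΓU : ΓR ∈ (unitaryGroupOfForm (galAdicCompletionMap (L := L) (IsCMField.complexConj L) hw) ((StdForm.antidiagonal 3).over (w.1.adicCompletion L))) := by rw [hΓR]; exact hU _
  have hGU : GR ∈ (unitaryGroupOfForm (galAdicCompletionMap (L := L) (IsCMField.complexConj L) hw) ((StdForm.antidiagonal 3).over (w.1.adicCompletion L))) := by rw [hGR]; exact hU _
  have hxg : XR = GR⁻¹ * ΓR * GR := by rw [hΓprod]; group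
  -- §3 integrality of `e x`, the 2-deep congruence of `e γ`
  have hxint : IsIntMatrix (XR : Matrix (Fin 3) (Fin 3) (w.1.adicCompletion L)) := by
    rw [hXR]; exact ((mem_glInt_iff_isIntMatrix L 3 w _).1 ((hKe x).1 hxK)).1
  have hX₀int : X₀ ∈ glInt 3 (w.1.adicCompletion L) := by
    rw [hX₀]; exact (mem_localIntegralLevel_iff_of_smul_eq (IsCMField.complexConj L) 3 H' hc1 w hw x).1 hxK
  have hΓ₀2' : IsIntMatrix (((toPlace v w (HeckeCharacter.uniformizer ↥(maximalRealSubfield L) v : v.adicCompletion ↥(maximalRealSubfield L))) ^ 2)⁻¹ • (((((localNonsplitEquiv (IsCMField.complexConj L) H' (IsCMField.complexConj_ne_one L) w hw (y * x * y⁻¹))).val : GL (Fin 3) (w.1.adicCompletion L)) : Matrix (Fin 3) (Fin 3) (w.1.adicCompletion L)) - 1)) := by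
    intro a b
    simpa only [Matrix.smul_apply, Matrix.sub_apply, smul_eq_mul] using hy a b
  have hΓ₀2 : IsIntMatrix (((toPlace v w (HeckeCharacter.uniformizer ↥(maximalRealSubfield L) v : v.adicCompletion ↥(maximalRealSubfield L))) ^ 2)⁻¹ • ((Γ₀ : Matrix (Fin 3) (Fin 3) (w.1.adicCompletion L)) - 1)) := by rw [hΓ₀]; exact hΓ₀2'
  have hΓR2 : IsIntMatrix (((toPlace v w (HeckeCharacter.uniformizer ↥(maximalRealSubfield L) v : v.adicCompletion ↥(maximalRealSubfield L))) ^ 2)⁻¹ • ((ΓR : Matrix (Fin 3) (Fin 3) (w.1.adicCompletion L)) - 1)) := by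
    have h := isIntMatrix_smul_conj_sub_one (((toPlace v w (HeckeCharacter.uniformizer ↥(maximalRealSubfield L) v : v.adicCompletion ↥(maximalRealSubfield L))) ^ 2)⁻¹) hTi hTi' hTT' hΓ₀2
    have hm : (ΓR : Matrix (Fin 3) (Fin 3) (w.1.adicCompletion L)) = (T : Matrix (Fin 3) (Fin 3) (w.1.adicCompletion L)) * (Γ₀ : Matrix (Fin 3) (Fin 3) (w.1.adicCompletion L)) * ((T⁻¹ : GL (Fin 3) (w.1.adicCompletion L)) : Matrix (Fin 3) (Fin 3) (w.1.adicCompletion L)) := by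
      rw [hΓRT]; simp only [Units.val_mul]
    rw [hm]; exact h
  -- §4 the residual nilpotent `N = red(x_w) − 1` and the dictionary «Jordan rank ↔ congruences»
  have hMx : ((X₀ : GL (Fin 3) (w.1.adicCompletion L)) : Matrix (Fin 3) (Fin 3) (w.1.adicCompletion L)) = (((x).val : GL (Fin 3) (UnitaryGroup.LocalRing L v)).val.map (Pi.evalRingHom (fun w' : PlacesOver L v => w'.1.adicCompletion L) w)) := by
    rw [hX₀]; exact coe_localNonsplitEquiv_apply L H' v w hw x
  obtain ⟨Nx, hNx⟩ : ∃ N : Matrix (Fin 3) (Fin 3) 𝓀[(w.1.adicCompletion L)], N = redMat ((X₀ : GL (Fin 3) (w.1.adicCompletion L)) : Matrix (Fin 3) (Fin 3) (w.1.adicCompletion L)) - 1 := ⟨_, rfl⟩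
  have hnilN : Nx ^ 3 = 0 := by rw [hNx, hMx]; exact hnil
  have hnilN' : IsNilpotent Nx := ⟨3, hnilN⟩
  have hX₀v : ValBound 1 ((X₀ : GL (Fin 3) (w.1.adicCompletion L)) : Matrix (Fin 3) (Fin 3) (w.1.adicCompletion L)) := valBound_one_of_mem_glInt hX₀int
  have hsubv : ValBound 1 (((X₀ : GL (Fin 3) (w.1.adicCompletion L)) : Matrix (Fin 3) (Fin 3) (w.1.adicCompletion L)) - 1) := by
    have h := hX₀v.sub valBound_one
    exact h
  have hredsub : redMat (((X₀ : GL (Fin 3) (w.1.adicCompletion L)) : Matrix (Fin 3) (Fin 3) (w.1.adicCompletion L)) - 1) = Nx := by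
    rw [hNx, redMat_sub hX₀v valBound_one, redMat_one]
  have hsqv : ValBound 1 ((((X₀ : GL (Fin 3) (w.1.adicCompletion L)) : Matrix (Fin 3) (Fin 3) (w.1.adicCompletion L)) - 1) ^ 2) := by
    have h := hsubv.mul hsubv
    rw [one_mul, ← sq] at h
    exact h
  have hredsq : redMat ((((X₀ : GL (Fin 3) (w.1.adicCompletion L)) : Matrix (Fin 3) (Fin 3) (w.1.adicCompletion L)) - 1) ^ 2) = Nx * Nx := by
    rw [sq, redMat_mul hsubv hsubv, hredsub]
  -- (a) `x_w ≡ 1 (ϖ)` forces `N = 0`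
  have hN0_of : IsIntMatrix ((toPlace v w (HeckeCharacter.uniformizer ↥(maximalRealSubfield L) v : v.adicCompletion ↥(maximalRealSubfield L)))⁻¹ • (((X₀ : GL (Fin 3) (w.1.adicCompletion L)) : Matrix (Fin 3) (Fin 3) (w.1.adicCompletion L)) - 1)) → Nx = 0 := fun hI => by
    have hle : ∀ i j, valuation (w.1.adicCompletion L) ((((X₀ : GL (Fin 3) (w.1.adicCompletion L)) : Matrix (Fin 3) (Fin 3) (w.1.adicCompletion L)) - 1) i j) ≤ valuation (w.1.adicCompletion L) (toPlace v w (HeckeCharacter.uniformizer ↥(maximalRealSubfield L) v : v.adicCompletion ↥(maximalRealSubfield L))) := fun i j =>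
      (v_le_iff_valuation_le _ _).1 ((UnitaryGroup.isIntMatrix_inv_smul_iff hϖ0 _).1 hI i j)
    have h0 : (redMat ((X₀ : GL (Fin 3) (w.1.adicCompletion L)) : Matrix (Fin 3) (Fin 3) (w.1.adicCompletion L)) - 1).rank = 0 := (rank_redMat_sub_one_eq_zero_iff_forall_valuation_le hϖ hX₀int).2 hle
    rw [← hNx] at h0
    exact (Literature.GroupTheory.SpecificGroups.rank_eq_zero_iff_eq_zero Nx).1 h0
  -- (b) `N² = 0` gives `(x_w − 1)² ≡ 0 (ϖ)`
  have hsq_of : Nx * Nx = 0 → IsIntMatrix ((toPlace v w (HeckeCharacter.uniformizer ↥(maximalRealSubfield L) v : v.adicCompletion ↥(maximalRealSubfield L)))⁻¹ • (((X₀ : GL (Fin 3) (w.1.adicCompletion L)) : Matrix (Fin 3) (Fin 3) (w.1.adicCompletion L)) - 1) ^ 2) := fun hsq => by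
    have hred0 : redMat ((((X₀ : GL (Fin 3) (w.1.adicCompletion L)) : Matrix (Fin 3) (Fin 3) (w.1.adicCompletion L)) - 1) ^ 2) = 0 := by rw [hredsq, hsq]
    have hlt := (redMat_eq_zero_iff_forall_valuation_lt_one hsqv).1 hred0
    refine (UnitaryGroup.isIntMatrix_inv_smul_iff hϖ0 _).2 fun i j => ?_
    rw [hϖv]
    exact (v_lt_one_iff _).1 ((v_lt_one_iff_valuation_lt_one _).2 (hlt i j))
  -- (c) `(x_w − 1)² ≡ 0 (ϖ)` gives `N² = 0`
  have hsq_of' : IsIntMatrix ((toPlace v w (HeckeCharacter.uniformizer ↥(maximalRealSubfield L) v : v.adicCompletion ↥(maximalRealSubfield L)))⁻¹ • (((X₀ : GL (Fin 3) (w.1.adicCompletion L)) : Matrix (Fin 3) (Fin 3) (w.1.adicCompletion L)) - 1) ^ 2) → Nx * Nx = 0 := fun hI => by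
    have hlt : ∀ i j, valuation (w.1.adicCompletion L) ((((((X₀ : GL (Fin 3) (w.1.adicCompletion L)) : Matrix (Fin 3) (Fin 3) (w.1.adicCompletion L)) - 1) ^ 2 : Matrix (Fin 3) (Fin 3) (w.1.adicCompletion L))) i j) < 1 := fun i j =>
      (v_lt_one_iff_valuation_lt_one _).1 (lt_of_le_of_lt ((UnitaryGroup.isIntMatrix_inv_smul_iff hϖ0 (((((X₀ : GL (Fin 3) (w.1.adicCompletion L)) : Matrix (Fin 3) (Fin 3) (w.1.adicCompletion L)) - 1) ^ 2 : Matrix (Fin 3) (Fin 3) (w.1.adicCompletion L)))).1 hI i j) hϖ1)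
    have h0 := (redMat_eq_zero_iff_forall_valuation_lt_one hsqv).2 hlt
    rwa [hredsq] at h0
  -- transports between `x_w` and `e x = T x_w T⁻¹`
  have hXm : (XR : Matrix (Fin 3) (Fin 3) (w.1.adicCompletion L)) = (T : Matrix (Fin 3) (Fin 3) (w.1.adicCompletion L)) * ((X₀ : GL (Fin 3) (w.1.adicCompletion L)) : Matrix (Fin 3) (Fin 3) (w.1.adicCompletion L)) * ((T⁻¹ : GL (Fin 3) (w.1.adicCompletion L)) : Matrix (Fin 3) (Fin 3) (w.1.adicCompletion L)) := by
    rw [hXRT]; simp only [Units.val_mul]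
  have hX₀m : ((X₀ : GL (Fin 3) (w.1.adicCompletion L)) : Matrix (Fin 3) (Fin 3) (w.1.adicCompletion L)) = ((T⁻¹ : GL (Fin 3) (w.1.adicCompletion L)) : Matrix (Fin 3) (Fin 3) (w.1.adicCompletion L)) * (XR : Matrix (Fin 3) (Fin 3) (w.1.adicCompletion L)) * (T : Matrix (Fin 3) (Fin 3) (w.1.adicCompletion L)) := by
    have h : X₀ = T⁻¹ * XR * T := by rw [hXRT]; group
    rw [h]; simp only [Units.val_mul]
  -- §6 the two ranks
  refine ⟨fun hr1 => ?_, fun hr2 => ?_⟩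
  · have hr1' : Nx.rank = 1 := by rw [hNx, hMx]; exact hr1
    obtain ⟨hNne, hsq⟩ := (rank_eq_one_iff_of_isNilpotent hnilN').1.1 hr1'
    have hx1 : ¬ IsIntMatrix ((toPlace v w (HeckeCharacter.uniformizer ↥(maximalRealSubfield L) v : v.adicCompletion ↥(maximalRealSubfield L)))⁻¹ • ((XR : Matrix (Fin 3) (Fin 3) (w.1.adicCompletion L)) - 1)) := fun hI => hNne (hN0_of (by
      rw [hX₀m]; exact isIntMatrix_smul_conj_sub_one ((toPlace v w (HeckeCharacter.uniformizer ↥(maximalRealSubfield L) v : v.adicCompletion ↥(maximalRealSubfield L)))⁻¹) hTi' hTi hT'T hI))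
    have hx2 : IsIntMatrix ((toPlace v w (HeckeCharacter.uniformizer ↥(maximalRealSubfield L) v : v.adicCompletion ↥(maximalRealSubfield L)))⁻¹ • ((XR : Matrix (Fin 3) (Fin 3) (w.1.adicCompletion L)) - 1) ^ 2) := by
      rw [hXm]; exact isIntMatrix_smul_conj_sub_one_sq ((toPlace v w (HeckeCharacter.uniformizer ↥(maximalRealSubfield L) v : v.adicCompletion ↥(maximalRealSubfield L)))⁻¹) hTi hTi' hTT' hT'T (hsq_of hsq)
    obtain ⟨k, n, u, hkU, hki, hki', hn, -, -, -, huU, hu2, hkxk⟩ :=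
      exists_conj_eq_levelTwo_mul_cornerUnipotent_of_two_deep_of_trace hd hN hΓU hΓR2 hGU hxg hxint hx1 hx2 ht₀ ht₀v
    exact apply_eq_of_conj_eq_levelTwo_mul L H' w hw g hginv hg2 T hT e he hKe hkU hki hki' huU hu2
      (by rw [← hXR, ← (Units.ext (by rw [hn, hnT]) : n = ((e nT).val : GL (Fin 3) (w.1.adicCompletion L)))]; exact hkxk)
  · have hr2' : Nx.rank = 2 := by rw [hNx, hMx]; exact hr2
    have hsq : Nx * Nx ≠ 0 := (rank_eq_one_iff_of_isNilpotent hnilN').2.1 hr2'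
    have hxreg : ¬ IsIntMatrix ((toPlace v w (HeckeCharacter.uniformizer ↥(maximalRealSubfield L) v : v.adicCompletion ↥(maximalRealSubfield L)))⁻¹ • ((XR : Matrix (Fin 3) (Fin 3) (w.1.adicCompletion L)) - 1) ^ 2) := fun hI => hsq (hsq_of' (by
      rw [hX₀m]; exact isIntMatrix_smul_conj_sub_one_sq ((toPlace v w (HeckeCharacter.uniformizer ↥(maximalRealSubfield L) v : v.adicCompletion ↥(maximalRealSubfield L)))⁻¹) hTi' hTi hT'T hTT' hI))
    obtain ⟨k, m, u, hkU, hki, hki', hm, -, -, -, huU, hu2, hkxk⟩ :=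
      exists_conj_eq_levelTwo_mul_upperUnipotent_one_of_two_deep_of_trace hd hΓU hΓR2 hGU hxg hxint hxreg hb₀ hb₀v
    exact apply_eq_of_conj_eq_levelTwo_mul L H' w hw g hginv hg2 T hT e he hKe hkU hki hki' huU hu2
      (by rw [← hXR, ← (Units.ext (by rw [hm, huT]) : m = ((e uT).val : GL (Fin 3) (w.1.adicCompletion L)))]; exact hkxk)

set_option maxHeartbeats 800000 in
-- budget only: one statement-heavy declaration (the END's organ-V tokens); no search tactic runs long here.
/-- **ORGAN V, BOUNDARY HALF — the two boundary values of a level-2 `K`-class piece** (END fold v3.2 `stub_liftValues`, BD-conjuncts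
VERBATIM): there is `c : ℕ → ℂ` with `c 0 = 0` such that `g x = c 1` (resp. `c 2`) for every `x ∈ K` with `(red x_w − 1)³ = 0`,
`rank(red x_w − 1) = 1` (resp. `2`) that is `G′_v`-conjugate into `K(2)`.  Proof: fix ONE good-reduction frame (★ `exists_frame_of_nonsplit`),
one skew unit `t₀` (★ `exists_v_mul_map_sub_lt_one_of_inert`'s companion ★ `exists_v_eq_one_and_map_eq_neg`) and `b₀ = −t` from the trace
datum; put `c 1 := g (e⁻¹ n(t₀))`, `c 2 := g (e⁻¹ u(1,b₀))` and apply `apply_eq_of_two_deep_of_rank_redMat_sub_one`.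
[cite: Rogawski1990, §3.9 p. 32, Prop. 3.9.1; §4.9 p. 54] [cite: Tits1979, §3.5] [cite: Kottwitz1986BaseChangeUnits, §1 pp. 240–241] -/
theorem exists_boundaryValues_of_levelTwo_anyChar
    (L : Type) [Field L] [NumberField L] [IsCMField L] (H' : Matrix (Fin 3) (Fin 3) L)
    {v : HeightOneSpectrum (𝓞 ↥(maximalRealSubfield L))}
    (hH' : (H'.map (cmConjRingHom L)).transpose = H') (w : PlacesOver L v)
    (hw : IsCMField.complexConj L • w.1 = w.1) (hv : Algebra.IsUnramifiedIn (𝓞 L) v.asIdeal)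
    (hH'w : IsUnit (placeForm H' w.1)) (hH'i : hH'w.unit ∈ glInt 3 (w.1.adicCompletion L))
    (g : ((cmDatum L 3 H').Local v) → ℂ)
    (hginv : ∀ u ∈ cmLocalIntegralLevel L 3 H' v, ∀ x, g (u * x * u⁻¹) = g x)
    (hg2 : ∀ u : ((cmDatum L 3 H').Local v),
      (∀ a b, Valued.v (((toPlace v w (HeckeCharacter.uniformizer ↥(maximalRealSubfield L) v : v.adicCompletion ↥(maximalRealSubfield L))) ^ 2)⁻¹ * (((((localNonsplitEquiv (IsCMField.complexConj L) H' (IsCMField.complexConj_ne_one L) w hw u) : ↥(unitaryGroupOfForm (galAdicCompletionMap (L := L) (IsCMField.complexConj L) hw) (placeForm H' w.1))) : GL (Fin 3) (w.1.adicCompletion L)) : Matrix (Fin 3) (Fin 3) (w.1.adicCompletion L)) a b - (1 : Matrix (Fin 3) (Fin 3) (w.1.adicCompletion L)) a b)) ≤ 1) →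
      ∀ x, g (u * x) = g x) :
    ∃ c : ℕ → ℂ, c 0 = 0 ∧
      (∀ x : ((cmDatum L 3 H').Local v), (x ∈ cmLocalIntegralLevel L 3 H' v ∧ (redMat (((x).val : GL (Fin 3) (UnitaryGroup.LocalRing L v)).val.map (Pi.evalRingHom (fun w' : PlacesOver L v => w'.1.adicCompletion L) w)) - 1) ^ 3 = 0 ∧ (redMat (((x).val : GL (Fin 3) (UnitaryGroup.LocalRing L v)).val.map (Pi.evalRingHom (fun w' : PlacesOver L v => w'.1.adicCompletion L) w)) - 1).rank = 1 ∧
        ∃ y : ((cmDatum L 3 H').Local v), (∀ a b, Valued.v (((toPlace v w (HeckeCharacter.uniformizer ↥(maximalRealSubfield L) v : v.adicCompletion ↥(maximalRealSubfield L))) ^ 2)⁻¹ * (((((localNonsplitEquiv (IsCMField.complexConj L) H' (IsCMField.complexConj_ne_one L) w hw (y * x * y⁻¹)) : ↥(unitaryGroupOfForm (galAdicCompletionMap (L := L) (IsCMField.complexConj L) hw) (placeForm H' w.1))) : GL (Fin 3) (w.1.adicCompletion L)) : Matrix (Fin 3) (Fin 3) (w.1.adicCompletion L)) a b - (1 : Matrix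 (Fin 3) (Fin 3) (w.1.adicCompletion L)) a b)) ≤ 1)) → g x = c 1) ∧
      (∀ x : ((cmDatum L 3 H').Local v), (x ∈ cmLocalIntegralLevel L 3 H' v ∧ (redMat (((x).val : GL (Fin 3) (UnitaryGroup.LocalRing L v)).val.map (Pi.evalRingHom (fun w' : PlacesOver L v => w'.1.adicCompletion L) w)) - 1) ^ 3 = 0 ∧ (redMat (((x).val : GL (Fin 3) (UnitaryGroup.LocalRing L v)).val.map (Pi.evalRingHom (fun w' : PlacesOver L v => w'.1.adicCompletion L) w)) - 1).rank = 2 ∧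
        ∃ y : ((cmDatum L 3 H').Local v), (∀ a b, Valued.v (((toPlace v w (HeckeCharacter.uniformizer ↥(maximalRealSubfield L) v : v.adicCompletion ↥(maximalRealSubfield L))) ^ 2)⁻¹ * (((((localNonsplitEquiv (IsCMField.complexConj L) H' (IsCMField.complexConj_ne_one L) w hw (y * x * y⁻¹)) : ↥(unitaryGroupOfForm (galAdicCompletionMap (L := L) (IsCMField.complexConj L) hw) (placeForm H' w.1))) : GL (Fin 3) (w.1.adicCompletion L)) : Matrix (Fin 3) (Fin 3) (w.1.adicCompletion L)) a b - (1 : Matrix (Fin 3) (Fin 3) (w.1.adicCompletion L)) a b)) ≤ 1)) → g x = c 2) := by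
  classical
  have hc1 : IsCMField.complexConj L ≠ 1 := IsCMField.complexConj_ne_one L
  -- the frame
  have hH'' : (H'.map (IsCMField.complexConj L))ᵀ = H' := by
    refine Eq.trans ?_ hH'
    rfl
  obtain ⟨T, e, hT, he, hKe, -⟩ := exists_frame_of_nonsplit L H' hH'' w hw hv hH'w hH'i
  have hJw : placeForm (Matrix.of fun i j : Fin 3 => if i.val + j.val + 1 = 3 then (1 : L) else 0) w.1 = ((StdForm.antidiagonal 3).over (w.1.adicCompletion L)) := by
    rw [placeForm, antidiagOne_eq_over, StdForm.over_map]
  -- the datum, a skew unit `t₀`, and `b₀ := -t`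
  have hϖv := Liu2021.LemD1IndexedNonVacuityInertCofinite.valued_toPlace_uniformizer_of_isUnramifiedIn L v hv w
  have hσϖ : (galAdicCompletionMap (L := L) (IsCMField.complexConj L) hw) (toPlace v w (HeckeCharacter.uniformizer ↥(maximalRealSubfield L) v : v.adicCompletion ↥(maximalRealSubfield L))) = (toPlace v w (HeckeCharacter.uniformizer ↥(maximalRealSubfield L) v : v.adicCompletion ↥(maximalRealSubfield L))) := galAdicCompletionMap_toPlace (IsCMField.complexConj L) w w hw _
  obtain ⟨ϖ₀, hd₀⟩ := unramifiedLocalConjDatum_adicCompletion (IsCMField.complexConj L) hc1 v w hw hv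
  have hd : UnramifiedLocalConjDatum (galAdicCompletionMap (L := L) (IsCMField.complexConj L) hw) (toPlace v w (HeckeCharacter.uniformizer ↥(maximalRealSubfield L) v : v.adicCompletion ↥(maximalRealSubfield L))) := ⟨hd₀.σσ, hd₀.vσ, hσϖ, hϖv, hd₀.trace, hd₀.norm⟩
  have hσne : ∃ x : (w.1.adicCompletion L), (galAdicCompletionMap (L := L) (IsCMField.complexConj L) hw) x ≠ x := UnitaryGroup.exists_galAdicCompletionMap_ne (IsCMField.complexConj L) hc1 v w hw
  obtain ⟨t₀, ht₀v, ht₀σ⟩ := hd.exists_v_eq_one_and_map_eq_neg hσne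
  have ht₀ : (galAdicCompletionMap (L := L) (IsCMField.complexConj L) hw) t₀ + t₀ = 0 := by rw [ht₀σ, neg_add_cancel]
  obtain ⟨t, htv, ht⟩ := hd.trace
  have hb₀ : (-t) + (galAdicCompletionMap (L := L) (IsCMField.complexConj L) hw) (-t) + 1 = 0 := by rw [map_neg, ← ht]; ring
  have hb₀v : Valued.v (-t) ≤ 1 := by rw [Valuation.map_neg]; exact htv
  -- the two normal forms, pulled back along `e`
  obtain ⟨n, hn, -⟩ := exists_units_coe_eq_cornerUnipotent (K := (w.1.adicCompletion L)) t₀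
  have hnU : n ∈ (unitaryGroupOfForm (galAdicCompletionMap (L := L) (IsCMField.complexConj L) hw) ((StdForm.antidiagonal 3).over (w.1.adicCompletion L))) := (mem_unitaryGroupOfForm_iff_of_coe_eq_cornerUnipotent (galAdicCompletionMap (L := L) (IsCMField.complexConj L) hw) hn).2 ht₀
  obtain ⟨m, hm, -⟩ := exists_units_coe_eq_upperTriangularUnipotent (1 : (w.1.adicCompletion L)) (-t) (-1)
  have hmU : m ∈ (unitaryGroupOfForm (galAdicCompletionMap (L := L) (IsCMField.complexConj L) hw) ((StdForm.antidiagonal 3).over (w.1.adicCompletion L))) := by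
    refine (mem_unitaryGroupOfForm_iff_of_coe_eq_upperUnipotent (galAdicCompletionMap (L := L) (IsCMField.complexConj L) hw) hd.σσ hm).2 ⟨by rw [map_one], ?_⟩
    rw [map_one, mul_one]; exact hb₀
  have hnU' : n ∈ (unitaryGroupOfForm (galAdicCompletionMap (L := L) (IsCMField.complexConj L) hw) (placeForm (Matrix.of fun i j : Fin 3 => if i.val + j.val + 1 = 3 then (1 : L) else 0) w.1)) := by rw [hJw]; exact hnU
  have hmU' : m ∈ (unitaryGroupOfForm (galAdicCompletionMap (L := L) (IsCMField.complexConj L) hw) (placeForm (Matrix.of fun i j : Fin 3 => if i.val + j.val + 1 = 3 then (1 : L) else 0) w.1)) := by rw [hJw]; exact hmU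
  obtain ⟨nT, hnT⟩ : ∃ z : ((cmDatum L 3 H').Local v), z = e.symm ⟨n, hnU'⟩ := ⟨_, rfl⟩
  obtain ⟨uT, huT⟩ : ∃ z : ((cmDatum L 3 H').Local v), z = e.symm ⟨m, hmU'⟩ := ⟨_, rfl⟩
  have henT : (((e nT).val : GL (Fin 3) (w.1.adicCompletion L)) : Matrix (Fin 3) (Fin 3) (w.1.adicCompletion L)) = !![1, 0, t₀; 0, 1, 0; 0, 0, 1] := by
    rw [hnT, e.apply_symm_apply]; exact hn
  have heuT : (((e uT).val : GL (Fin 3) (w.1.adicCompletion L)) : Matrix (Fin 3) (Fin 3) (w.1.adicCompletion L)) = !![1, 1, -t; 0, 1, -1; 0, 0, 1] := by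
    rw [huT, e.apply_symm_apply]; exact hm
  refine ⟨fun s => if s = 1 then g nT else if s = 2 then g uT else 0, by simp, ?_, ?_⟩
  · rintro x ⟨hxK, hnil, hr, y, hy⟩
    have h := (apply_eq_of_two_deep_of_rank_redMat_sub_one_anyChar L H' w hw hv g hginv hg2 T hT e he hKe ht₀ ht₀v hb₀ hb₀v
      nT uT henT heuT hxK hnil hy).1 hr
    simpa using h
  · rintro x ⟨hxK, hnil, hr, y, hy⟩
    have h := (apply_eq_of_two_deep_of_rank_redMat_sub_one_anyChar L H' w hw hv g hginv hg2 T hT e he hKe ht₀ ht₀v hb₀ hb₀v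
      nT uT henT heuT hxK hnil hy).2 hr
    simpa using h

end OrganVBoundary

end Literature.NumberTheory.Rogawski1990
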